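import Literature.NumberTheory.Sieve.JurkatRichertContinuous
import Literature.NumberTheory.Sieve.JurkatRichertPartialSummation
import Literature.NumberTheory.Sieve.RosserSieveInductionStep
import HarnessLib

/-!
# The explicit linear sieve: Nathanson's Theorems 9.5 and 9.6 (upper bound) with `F(s) = 2e^γ/s`

Topic `Literature/NumberTheory/Sieve`; fourth file of the explicit form of the Jurkat–Richert
theorem following M. B. Nathanson, *Additive Number Theory: The Classical Bases*, GTM 164 (1996),
Ch. 9, §9.4 (PDF pp. 158–160 of the held copy) [Nathanson1996]. Everything here is PROVED.

For Rosser's weights with `β = 2` and level `D` over the primes `< z` (`BetaSieve.pred`,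
`BetaSieve.bdrySum par g 2 D (P(z)) n = T_n(D, z)`, `BetaSieve.mainSum 1 g 2 D (P(z)) = G(z, λ⁺)`)
and a multiplicative `g` with `0 ≤ g(p) < 1` (`p < z`) satisfying the linear-sieve condition
`∏_{u ≤ p < w} (1 − g(p))⁻¹ ≤ K log w/log u` for all `1 < u < w ≤ z` (`JurkatRichert.KCond`;
Nathanson's (9.29), needed at EVERY level `w ≤ z`, see below), `1 ≤ K ≤ 1 + 1/200`:

* **Theorem 9.5** (`JurkatRichert.bdrySum_le`): `T_n(D, z) ≤ V(z) (f_n(s) + (K − 1) c_n m_n(s))`,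
  `s = log D/log z`, for `n` odd and `s ≥ 1` or `n` even and `s ≥ 2`, by induction on `n` exactly as
  printed — the recursion (9.13)–(9.15) (`BetaSieve.bdrySum_one_one_eq`, `bdrySum_succ_succ`,
  `bdrySum_one_succ_succ_eq`), Lemma 9.8 (`BetaSieve.sum_primesBelow_le_of_kTail`), the substitution
  `t = log D/log u`, the recursion (9.21)–(9.22) of the continuous models
  (`BetaSieve.contS_succ_succ_eq_integral`; `s f_n(s) = contS 1 2 n s`) and Lemma 9.7
  (`JurkatRichert.contS_le_majorant`) — with the error majorants of `JurkatRichertMajorants.lean`: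
  `m_n = m_o` (`moFun`) for odd `n`, `m_n = h` (`hFun`) for even `n`, `c_n = 12000 α^n`
  (`JurkatRichert.cN`). Nathanson's own bookkeeping `h_n = (K − 1) τ^n e^{10} h` is replaced because
  of the ERRATUM documented in `JurkatRichertMajorants.lean` (for odd `n` and `1 ≤ s < 3` one must use
  `T_n(D, z) = T_n(D, D^{1/3})` and `V(D^{1/3}) ≤ (3K/s) V(z)`, which his `h` cannot absorb near
  `s = 1`); the constants close because `∫_{s−1} m_o ≤ (9/10) s h(s)`, `∫_{s−1} h ≤ (9/10) s m_o(s)`,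
  `m(s − 1) ≤ 4 m'(s)`, `f_n ≤ 2e³ α^{n−1} m_n` and `12000 α(α − Kρ) ≥ e³(10K + 2α)`,
  `ρ = 9K/10 + 4(K − 1)`, `0.96 ≤ α ≤ 0.961`.
* **Theorem 9.6, upper bound, with Theorem 9.8** (`JurkatRichert.mainSum_one_le`): for `1 ≤ s ≤ 3`,
  `G(z, λ⁺) ≤ V(z) (2e^γ/s + (K − 1) e^{14−s})`
  (`G = V + Σ_{n odd} T_n`, `BetaSieve.mainSum_one_eq`; `1 + Σ_{n odd} f_n(s) ≤ 2e^γ/s`,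
  `JurkatRichert.add_contT_one_le`; `Σ_{n odd} (K − 1) c_n m_o(s) ≤ (K − 1) · 12000 · 26 · 3e^{−3}/s
  ≤ (K − 1) e^{14−s}`).

On the hypothesis: the printed Theorems 9.5–9.7 require (9.29)/(9.34) "for all `1 < u < z`" with
`z` the sieving level of the statement, but the induction applies Theorem 9.5 (hence Lemma 9.8) at
the levels `p < z` of the recursion (9.14)–(9.15), i.e. it uses the condition at every level
`w ≤ z`; this is what `KCond g K z` records (and what the applications in Ch. 10 verify, via Mertens'
theorem, for every pair `u < w`).

## References

* M. B. Nathanson, *Additive Number Theory: The Classical Bases*, GTM 164, Springer (1996), Ch. 9,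
  Lemmas 9.3–9.4, 9.8, Theorems 9.5, 9.6, 9.8. [Nathanson1996]
* H. Iwaniec, *Rosser's sieve*, Acta Arith. 36 (1980), 171–202, §4, §8. [IwaniecActaArith1980]
-/

open Set MeasureTheory intervalIntegral Real Finset
open scoped ArithmeticFunction.Moebius ArithmeticFunction.omega

noncomputable section

namespace Literature.NumberTheory.Sieve

namespace JurkatRichert

open BetaSieve BetaSieveForward

/-! ### The linear-sieve condition at all levels `≤ z` -/

/-- **Nathanson's condition (9.29)/(9.34) at every level `w ≤ z`**: for all `1 < u < w ≤ z`,
`∏_{u ≤ p < w} (1 − g(p))⁻¹ ≤ K log w / log u` (the product over the primes `p` with `u ≤ p < w`).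
The printed theorems state it for the top level `w = z` only, but their proofs use it at all levels
(see the module docstring). [cite: Nathanson1996, Lemma 9.8 (9.29) and Thm 9.7 (9.34)] -/
def KCond (g : ArithmeticFunction ℝ) (K z : ℝ) : Prop :=
  ∀ w u : ℝ, 1 < u → u < w → w ≤ z →
    ∏ p ∈ (Nat.primesBelow ⌈w⌉₊).filter (fun p : ℕ => u ≤ (p : ℝ)), (1 - g p)⁻¹ ≤
      K * (Real.log w / Real.log u)

variable {g : ArithmeticFunction ℝ} {K z : ℝ}

/-- The condition is inherited by lower levels. [folklore] -/
theorem KCond.mono (h : KCond g K z) {z' : ℝ} (hz' : z' ≤ z) : KCond g K z' :=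
  fun w u hu huw hwz => h w u hu huw (hwz.trans hz')

/-- `V(P(w)) > 0` when `g(p) < 1` for the primes `p < z`, `w ≤ z`. [folklore] -/
theorem vprod_pos_of_lt (h01 : ∀ p : ℕ, p.Prime → (p : ℝ) < z → 0 ≤ g p ∧ g p < 1) {w : ℝ}
    (hw : w ≤ z) : 0 < vprod g (primesProdBelow w) := by
  refine Finset.prod_pos fun p hp => sub_pos.mpr ?_
  rw [primeFactors_primesProdBelow, Nat.mem_primesBelow] at hp
  exact (h01 p hp.2 (lt_of_lt_of_le (Nat.lt_ceil.mp hp.1) hw)).2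

/-- `0 ≤ g(p) ≤ 1` on the prime factors of `P(w)`, `w ≤ z` (the form used by `bdrySum_nonneg`).
[folklore] -/
theorem h01_primeFactors (h01 : ∀ p : ℕ, p.Prime → (p : ℝ) < z → 0 ≤ g p ∧ g p < 1) {w : ℝ}
    (hw : w ≤ z) : ∀ p ∈ (primesProdBelow w).primeFactors, 0 ≤ g p ∧ g p ≤ 1 := by
  intro p hp
  rw [primeFactors_primesProdBelow, Nat.mem_primesBelow] at hp
  have h := h01 p hp.2 (lt_of_lt_of_le (Nat.lt_ceil.mp hp.1) hw)
  exact ⟨h.1, h.2.le⟩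

/-- **The one-sided comparison of `V` from the condition**: `V(P(u)) ≤ K (log w/log u) V(P(w))` for
`1 < u < w ≤ z` (Nathanson, proof of Lemma 9.8: `V(u)/V(z) = ∏_{u ≤ p < z} (1 − g(p))⁻¹`).
[cite: Nathanson1996, Lemma 9.8 (proof)] -/
theorem KCond.vprod_le (h : KCond g K z)
    (h01 : ∀ p : ℕ, p.Prime → (p : ℝ) < z → 0 ≤ g p ∧ g p < 1) {u w : ℝ} (hu : 1 < u) (huw : u < w)
    (hwz : w ≤ z) :
    vprod g (primesProdBelow u) ≤ K * (Real.log w / Real.log u) * vprod g (primesProdBelow w) := by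
  have hsplit : vprod g (primesProdBelow w) = vprod g (primesProdBelow u) *
      ∏ p ∈ (Nat.primesBelow ⌈w⌉₊).filter (fun p : ℕ => u ≤ (p : ℝ)), (1 - g p) := by
    rw [vprod, vprod, primeFactors_primesProdBelow, primeFactors_primesProdBelow,
      ← Finset.prod_filter_mul_prod_filter_not (Nat.primesBelow ⌈w⌉₊) (fun p : ℕ => (p : ℝ) < u)]
    congr 1
    · refine Finset.prod_congr ?_ fun _ _ => rfl
      ext p
      simp only [Finset.mem_filter, Nat.mem_primesBelow, Nat.lt_ceil]
      constructor
      · rintro ⟨⟨-, hp⟩, hlt⟩; exact ⟨hlt, hp⟩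
      · rintro ⟨hlt, hp⟩; exact ⟨⟨lt_trans hlt huw, hp⟩, hlt⟩
    · refine Finset.prod_congr ?_ fun _ _ => rfl
      exact Finset.filter_congr fun p _ => not_lt
  have hpos : 0 < ∏ p ∈ (Nat.primesBelow ⌈w⌉₊).filter (fun p : ℕ => u ≤ (p : ℝ)), (1 - g p) := by
    refine Finset.prod_pos fun p hp => sub_pos.mpr ?_
    rw [Finset.mem_filter, Nat.mem_primesBelow] at hp
    exact (h01 p hp.1.2 (lt_of_lt_of_le (Nat.lt_ceil.mp hp.1.1) hwz)).2
  have hK := h w u hu huw hwz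
  rw [Finset.prod_inv_distrib] at hK
  have hV0 : 0 ≤ vprod g (primesProdBelow u) := (vprod_pos_of_lt h01 (huw.le.trans hwz)).le
  calc vprod g (primesProdBelow u)
      = vprod g (primesProdBelow u) *
          ((∏ p ∈ (Nat.primesBelow ⌈w⌉₊).filter (fun p : ℕ => u ≤ (p : ℝ)), (1 - g p))⁻¹ *
          ∏ p ∈ (Nat.primesBelow ⌈w⌉₊).filter (fun p : ℕ => u ≤ (p : ℝ)), (1 - g p)) := by
        rw [inv_mul_cancel₀ hpos.ne', mul_one]
    _ ≤ vprod g (primesProdBelow u) * ((K * (Real.log w / Real.log u)) *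
          ∏ p ∈ (Nat.primesBelow ⌈w⌉₊).filter (fun p : ℕ => u ≤ (p : ℝ)), (1 - g p)) :=
        mul_le_mul_of_nonneg_left (mul_le_mul_of_nonneg_right hK hpos.le) hV0
    _ = K * (Real.log w / Real.log u) * vprod g (primesProdBelow w) := by rw [hsplit]; ring

/-! ### The majorant constants `c_n` and shapes `m_n` -/

/-- `c_n = 12000 α^n`, the constant of the error majorant of index `n`. [folklore] -/
def cN (n : ℕ) : ℝ := 12000 * alphaN ^ n

/-- `m_n = m_o` for odd `n`, `= h` for even `n`. [folklore] -/
def major (n : ℕ) (s : ℝ) : ℝ := if n % 2 = 1 then moFun s else hFun s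

/-- `m_n = m_o` for odd `n`. [folklore] -/
theorem major_of_odd {n : ℕ} (h : n % 2 = 1) (s : ℝ) : major n s = moFun s := if_pos h

/-- `m_n = h` for even `n`. [folklore] -/
theorem major_of_even {n : ℕ} (h : n % 2 = 0) (s : ℝ) : major n s = hFun s := if_neg (by omega)

/-- `0 < c_n`. [folklore] -/
theorem cN_pos (n : ℕ) : 0 < cN n := by
  unfold cN; have := alphaN_pos; positivity

/-- `c_{n+1} = α c_n`. [folklore] -/
theorem cN_succ (n : ℕ) : cN (n + 1) = alphaN * cN n := by
  unfold cN; ring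

/-- `0 < m_n`. [folklore] -/
theorem major_pos (n : ℕ) (s : ℝ) : 0 < major n s := by
  unfold major; split_ifs; exacts [moFun_pos s, hFun_pos s]

/-- `m_n` is continuous. [folklore] -/
theorem continuous_major (n : ℕ) : Continuous (major n) := by
  unfold major; split_ifs; exacts [continuous_moFun, continuous_hFun]

/-- `m_n` is non-increasing. [folklore] -/
theorem antitone_major (n : ℕ) : Antitone (major n) := by
  intro a b hab; unfold major; split_ifs; exacts [antitone_moFun hab, antitone_hFun hab]

/-- `h ≤ e · m_n`. [folklore] -/
theorem hFun_le_exp_mul_major (n : ℕ) (s : ℝ) : hFun s ≤ Real.exp 1 * major n s := by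
  unfold major; split_ifs
  · exact hFun_le_exp_one_mul_moFun s
  · have h1 : 1 ≤ Real.exp 1 := Real.one_le_exp (by norm_num)
    nlinarith [hFun_pos s]

/-- Lemma 9.7 against `m_n`: `S_n(s) ≤ 2e³ α^{n−1} s m_n(s)` (`n` odd, `s ≥ 1`; `n` even, `s ≥ 2`).
[cite: Nathanson1996, Lemma 9.7] -/
theorem contS_le_major {n : ℕ} (hn : 1 ≤ n) {s : ℝ} (hodd : n % 2 = 1 → 1 ≤ s)
    (heven : n % 2 = 0 → 2 ≤ s) :
    contS 1 2 n s ≤ 2 * Real.exp 3 * alphaN ^ (n - 1) * (s * major n s) := by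
  have h := contS_le_majorant n s hn hodd heven
  have hs : 0 ≤ s := by rcases Nat.mod_two_eq_zero_or_one n with h0 | h1 <;> [linarith [heven h0]; linarith [hodd h1]]
  have h2 : s * hFun s ≤ s * (Real.exp 1 * major n s) :=
    mul_le_mul_of_nonneg_left (hFun_le_exp_mul_major n s) hs
  have he : Real.exp 3 = Real.exp 2 * Real.exp 1 := by rw [← Real.exp_add]; norm_num
  have hα : 0 ≤ alphaN ^ (n - 1) := pow_nonneg alphaN_pos.le _
  calc contS 1 2 n s ≤ 2 * Real.exp 2 * alphaN ^ (n - 1) * (s * hFun s) := h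
    _ ≤ 2 * Real.exp 2 * alphaN ^ (n - 1) * (s * (Real.exp 1 * major n s)) :=
        mul_le_mul_of_nonneg_left h2 (by positivity)
    _ = 2 * Real.exp 3 * alphaN ^ (n - 1) * (s * major n s) := by rw [he]; ring

/-- The shift bound `m_{n+1}(s − 1) ≤ 4 m_{n+2}(s)` in the ranges of the induction (`n` even:
`m_o(s − 1) ≤ 4 h(s)`, `s ≥ 2`; `n` odd: `h(s − 1) ≤ 4 m_o(s)`, `s ≥ 3`). [folklore] -/
theorem major_succ_sub_one_le {m : ℕ} {s : ℝ} (heven : m % 2 = 0 → 2 ≤ s) (hodd : m % 2 = 1 → 3 ≤ s) :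
    major (m + 1) (s - 1) ≤ 4 * major (m + 2) s := by
  rcases Nat.mod_two_eq_zero_or_one m with h0 | h1
  · rw [major_of_odd (by omega), major_of_even (by omega)]
    exact moFun_sub_one_le (heven h0)
  · rw [major_of_even (by omega), major_of_odd (by omega)]
    exact hFun_sub_one_le_moFun (hodd h1)

/-- The transfer bound `∫_{s−1}^T m_{n+1} ≤ (9/10) s m_{n+2}(s)` in the ranges of the induction.
[folklore] -/
theorem integral_major_succ_le {m : ℕ} {s T : ℝ} (heven : m % 2 = 0 → 2 ≤ s) (hodd : m % 2 = 1 → 3 ≤ s)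
    (hT : s - 1 ≤ T) : ∫ t in (s - 1)..T, major (m + 1) t ≤ 9 / 10 * s * major (m + 2) s := by
  rcases Nat.mod_two_eq_zero_or_one m with h0 | h1
  · rw [show major (m + 1) = moFun from funext fun t => major_of_odd (by omega) t,
      major_of_even (by omega)]
    exact integral_moFun_le (heven h0) hT
  · rw [show major (m + 1) = hFun from funext fun t => major_of_even (by omega) t,
      major_of_odd (by omega)]
    exact integral_hFun_le_moFun (hodd h1) hT

/-! ### Numerics of the constants -/

/-- `e³ < 20.1`. [folklore] -/
theorem exp_three_lt : Real.exp 3 < 20.1 := by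
  have h := Real.exp_one_lt_d9
  have h3 : Real.exp 3 = Real.exp 1 ^ 3 := by rw [← Real.exp_nat_mul]; norm_num
  have hp : Real.exp 1 ^ 3 < (2.7182818286 : ℝ) ^ 3 := pow_lt_pow_left₀ h (Real.exp_pos 1).le (by norm_num)
  rw [h3]
  exact hp.trans (by norm_num)

/-- `312000 ≤ e^{14}`. [folklore] -/
theorem le_exp_fourteen : (312000 : ℝ) ≤ Real.exp 14 := by
  have h := Real.exp_one_gt_d9
  have h14 : Real.exp 14 = Real.exp 1 ^ 14 := by rw [← Real.exp_nat_mul]; norm_num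
  have hp : (2.718 : ℝ) ^ 14 ≤ Real.exp 1 ^ 14 :=
    pow_le_pow_left₀ (by norm_num) (le_trans (by norm_num) h.le) 14
  rw [h14]
  exact le_trans (by norm_num) hp

/-- The recursion inequality for the constants: for `1 ≤ K ≤ 201/200`,
`K (c_{m+1} (9K/10 + 4(K − 1)) + 10 e³ α^m) + 2 e³ α^{m+1} ≤ c_{m+2}`
(i.e. `12000 α (α − Kρ) ≥ e³ (10K + 2α)`, `ρ = 9K/10 + 4(K − 1) ≤ 0.9245`, `0.96 ≤ α`). [folklore] -/
theorem cN_step {K : ℝ} (hK1 : 1 ≤ K) (hK2 : K ≤ 201 / 200) (m : ℕ) :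
    K * (cN (m + 1) * (9 / 10 * K + 4 * (K - 1)) + 10 * Real.exp 3 * alphaN ^ m) +
      2 * Real.exp 3 * alphaN ^ (m + 1) ≤ cN (m + 2) := by
  obtain ⟨hα1, hα2⟩ := alphaN_bounds
  have he3 := exp_three_lt
  have hαm : 0 < alphaN ^ m := pow_pos alphaN_pos m
  unfold cN
  rw [pow_succ, pow_succ, pow_succ]
  -- divide by `α^m > 0`
  have key : K * (12000 * alphaN * (9 / 10 * K + 4 * (K - 1)) + 10 * Real.exp 3) +
      2 * Real.exp 3 * alphaN ≤ 12000 * (alphaN * alphaN) := by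
    nlinarith [mul_nonneg (sub_nonneg.2 hK1) (sub_nonneg.2 hα1), Real.exp_pos (3 : ℝ),
      mul_nonneg (sub_nonneg.2 hK2) (sub_nonneg.2 hα1)]
  nlinarith [mul_le_mul_of_nonneg_left key hαm.le]

/-- The base case constant: `3 ≤ c_1 · 3e^{−3}` (i.e. `e³ ≤ 12000 α`). [folklore] -/
theorem three_le_cN_one_mul : 3 ≤ cN 1 * (3 * Real.exp (-3)) := by
  obtain ⟨hα1, -⟩ := alphaN_bounds
  unfold cN
  have h3 : Real.exp 3 * Real.exp (-3) = 1 := by rw [← Real.exp_add]; norm_num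
  have he3 := exp_three_lt
  nlinarith [Real.exp_pos (-3 : ℝ), Real.exp_pos (3 : ℝ)]

/-- The final error budget: `12000 · 26 · m_o(s) ≤ e^{14−s}` for `1 ≤ s ≤ 3`
(`m_o(s) = 3e^{−3}/s`; `936000 e^{−3} ≤ 3 e^{11} ≤ s (4 − s) e^{11} ≤ s e^{14−s}`). [folklore] -/
theorem errorBudget {s : ℝ} (hs1 : 1 ≤ s) (hs3 : s ≤ 3) :
    12000 * 26 * moFun s ≤ Real.exp (14 - s) := by
  rw [moFun_of_mem hs1 hs3]
  have hs0 : 0 < s := by linarith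
  have he14 := le_exp_fourteen
  have hsplit14 : Real.exp 14 = Real.exp 11 * Real.exp 3 := by rw [← Real.exp_add]; norm_num
  have hsplit : Real.exp (14 - s) = Real.exp 11 * Real.exp (3 - s) := by
    rw [← Real.exp_add]; congr 1; ring
  have h3 : Real.exp 3 * Real.exp (-3) = 1 := by rw [← Real.exp_add]; norm_num
  have hexp : 1 + (3 - s) ≤ Real.exp (3 - s) := by
    have := Real.add_one_le_exp (3 - s); linarith
  have hss : 3 ≤ s * (4 - s) := by nlinarith
  -- `936000 e^{-3} ≤ 3 e^{11}`
  have hA : 936000 * Real.exp (-3) ≤ 3 * Real.exp 11 := by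
    have : 312000 * Real.exp (-3) ≤ Real.exp 11 := by
      have h1 : 312000 * Real.exp (-3) ≤ Real.exp 14 * Real.exp (-3) :=
        mul_le_mul_of_nonneg_right he14 (Real.exp_pos _).le
      rw [hsplit14, mul_assoc, h3, mul_one] at h1
      exact h1
    linarith
  -- `3 e^{11} ≤ s e^{14-s}`
  have hB : 3 * Real.exp 11 ≤ s * Real.exp (14 - s) := by
    rw [hsplit]
    have h11 : 0 < Real.exp 11 := Real.exp_pos _
    have : 3 ≤ s * Real.exp (3 - s) := by nlinarith
    nlinarith
  rw [show 12000 * 26 * (3 * Real.exp (-3) / s) = 936000 * Real.exp (-3) / s by ring,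
    div_le_iff₀ hs0]
  linarith


/-! ### The step function `Ψ` of the induction -/

/-- `Ψ_{m,K}(t) = S_{m+1}(t − 1)/max(t − 1, 1) + (K − 1) c_{m+1} m_{m+1}(t − 1)`: Nathanson's
`Φ(u) = f_{n−1}(log D/log u − 1) + h_{n−1}(log D/log u − 1)` as a function of `t = log D/log u`
(the `max` only makes `Ψ` continuous on `ℝ`; on the range `t ≥ 2` it is inactive).
[cite: Nathanson1996, Thm 9.5 (proof)] -/
def stepFun (m : ℕ) (K : ℝ) (t : ℝ) : ℝ :=
  contS 1 2 (m + 1) (t - 1) / max (t - 1) 1 + (K - 1) * cN (m + 1) * major (m + 1) (t - 1)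

/-- `Ψ` is continuous. [folklore] -/
theorem continuous_stepFun (m : ℕ) (K : ℝ) : Continuous (stepFun m K) := by
  unfold stepFun
  refine Continuous.add ?_ ?_
  · refine ((continuous_contS zero_le_one (by norm_num) (m + 1)).comp
      (continuous_id.sub continuous_const)).div
      ((continuous_id.sub continuous_const).max continuous_const) fun t => ?_
    exact ne_of_gt (lt_of_lt_of_le zero_lt_one (le_max_right _ _))
  · exact continuous_const.mul ((continuous_major (m + 1)).comp (continuous_id.sub continuous_const))

/-- `Ψ(t)` for `t ≥ 2` (the `max` is inactive). [folklore] -/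
theorem stepFun_of_two_le (m : ℕ) (K : ℝ) {t : ℝ} (ht : 2 ≤ t) :
    stepFun m K t = contS 1 2 (m + 1) (t - 1) / (t - 1) + (K - 1) * cN (m + 1) * major (m + 1) (t - 1) := by
  rw [stepFun, max_eq_left (by linarith)]

/-- `Ψ ≥ 0` on `t ≥ 2` (`K ≥ 1`). [folklore] -/
theorem stepFun_nonneg (m : ℕ) {K : ℝ} (hK : 1 ≤ K) {t : ℝ} (ht : 2 ≤ t) : 0 ≤ stepFun m K t := by
  rw [stepFun_of_two_le m K ht]
  have h1 : 0 ≤ contS 1 2 (m + 1) (t - 1) := contS_one_two_nonneg _ (by linarith)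
  have h2 : 0 < major (m + 1) (t - 1) := major_pos _ _
  have h3 := cN_pos (m + 1)
  have : 0 ≤ contS 1 2 (m + 1) (t - 1) / (t - 1) := div_nonneg h1 (by linarith)
  have : 0 ≤ (K - 1) * cN (m + 1) * major (m + 1) (t - 1) := by
    have : 0 ≤ K - 1 := by linarith
    positivity
  linarith

/-- `Ψ` is non-increasing on `[2, ∞)` (`f_{m+1}` and the majorants are non-increasing; `K ≥ 1`).
[cite: Nathanson1996, Thm 9.5 (proof: "Φ is … increasing")] -/
theorem stepFun_anti (m : ℕ) {K : ℝ} (hK : 1 ≤ K) {a b : ℝ} (ha : 2 ≤ a) (hab : a ≤ b) :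
    stepFun m K b ≤ stepFun m K a := by
  rw [stepFun_of_two_le m K ha, stepFun_of_two_le m K (ha.trans hab)]
  have hanti := contS_antitoneOn (κ := 1) (β := 2) zero_le_one (by norm_num) (m + 1)
  have h1 : contS 1 2 (m + 1) (b - 1) ≤ contS 1 2 (m + 1) (a - 1) :=
    hanti (show (0 : ℝ) ≤ a - 1 by linarith) (show (0 : ℝ) ≤ b - 1 by linarith) (by linarith)
  have h2 : contS 1 2 (m + 1) (b - 1) / (b - 1) ≤ contS 1 2 (m + 1) (a - 1) / (a - 1) :=
    div_le_div₀ (contS_one_two_nonneg _ (by linarith)) h1 (by linarith) (by linarith)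
  have h3 : major (m + 1) (b - 1) ≤ major (m + 1) (a - 1) := antitone_major _ (by linarith)
  have h4 : (K - 1) * cN (m + 1) * major (m + 1) (b - 1) ≤ (K - 1) * cN (m + 1) * major (m + 1) (a - 1) :=
    mul_le_mul_of_nonneg_left h3 (mul_nonneg (by linarith) (cN_pos _).le)
  linarith

/-! ### Theorem 9.5: the induction step -/

/-- **The induction step of Theorem 9.5** (Nathanson pp. 255–256, for `n = m + 2` even and `s ≥ 2`,
or odd and `s ≥ 3`): if every `T_{m+1}(D/p, p)`, `p < z` (with `p³ < D` when `m` is odd), is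
bounded by `V(p)(f_{m+1}(s_p) + (K − 1) c_{m+1} m_{m+1}(s_p))`, `s_p = log(D/p)/log p`, then
`T_{m+2}(D, z) ≤ V(z)(f_{m+2}(s) + (K − 1)(c_{m+1}(9K/10 + 4(K − 1)) + 10e³ α^m) m_{m+2}(s))`.
Ingredients as printed: (9.14)/(9.15), Lemma 9.8, `t = log D/log u`, (9.21), Lemma 9.6 (in the
transfer form of `JurkatRichertMajorants`), `h(s − 1) ≤ 4h(s)`, Lemma 9.7.
[cite: Nathanson1996, Thm 9.5 (proof)] -/
theorem bdrySum_step (hg : g.IsMultiplicative)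
    (h01 : ∀ p : ℕ, p.Prime → (p : ℝ) < z → 0 ≤ g p ∧ g p < 1) (hK1 : 1 ≤ K) (hKC : KCond g K z)
    (hz : 2 ≤ z) (m : ℕ) {D : ℝ} (hD : 1 < D) (hs : 2 + parityShift m ≤ Real.log D / Real.log z)
    (hIH : ∀ p ∈ Nat.primesBelow ⌈z⌉₊, (m % 2 = 1 → ((p : ℕ) : ℝ) ^ ((2 : ℝ) + 1) < D) →
      bdrySum ((m + 1) % 2) g 2 (D / p) (primesProdBelow p) (m + 1) ≤
        vprod g (primesProdBelow p) *
          (contS 1 2 (m + 1) (Real.log (D / p) / Real.log p) / (Real.log (D / p) / Real.log p) +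
            (K - 1) * cN (m + 1) * major (m + 1) (Real.log (D / p) / Real.log p))) :
    bdrySum (m % 2) g 2 D (primesProdBelow z) (m + 2) ≤
      vprod g (primesProdBelow z) *
        (contS 1 2 (m + 2) (Real.log D / Real.log z) / (Real.log D / Real.log z) +
          (K - 1) * (cN (m + 1) * (9 / 10 * K + 4 * (K - 1)) + 10 * Real.exp 3 * alphaN ^ m) *
            major (m + 2) (Real.log D / Real.log z)) := by
  set s := Real.log D / Real.log z with hs_def
  have hz1 : 1 < z := by linarith
  have hz0 : 0 < z := by linarith
  have hlogz : 0 < Real.log z := Real.log_pos hz1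
  have hlogD : 0 < Real.log D := Real.log_pos hD
  have hD0 : 0 < D := by linarith
  have hps0 := (parityShift_mem m).1
  have hs2 : 2 ≤ s := by linarith
  have hs1 : 1 < s := by linarith
  have hK0 : 0 ≤ K - 1 := by linarith
  have hVz : 0 < vprod g (primesProdBelow z) := vprod_pos_of_lt h01 le_rfl
  set Ψ := stepFun m K with hΨ
  set Φ : ℝ → ℝ := fun u => Ψ (Real.log D / Real.log u) with hΦ
  set M := major (m + 2) s with hM
  have hM0 : 0 < M := major_pos _ _
  have hc0 := cN_pos (m + 1)
  -- Step 1: the recursion (9.14)/(9.15) and the induction hypothesis, termwise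
  have hsum : bdrySum (m % 2) g 2 D (primesProdBelow z) (m + 2) ≤
      ∑ p ∈ Nat.primesBelow ⌈z⌉₊, g p * vprod g (primesProdBelow p) * Φ p := by
    rw [bdrySum_succ_succ hg (m % 2) 2 D z m]
    refine Finset.sum_le_sum fun p hp => ?_
    have hpp : p.Prime := Nat.prime_of_mem_primesBelow hp
    have hpz : (p : ℝ) < z := Nat.lt_ceil.mp (Nat.lt_of_mem_primesBelow hp)
    have hp2 : (2 : ℝ) ≤ p := by exact_mod_cast hpp.two_le
    have hp0 : (0 : ℝ) < p := by linarith
    have hlogp : 0 < Real.log p := Real.log_pos (by linarith)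
    have hlogpz : Real.log p < Real.log z := Real.log_lt_log hp0 hpz
    have hg0 : 0 ≤ g p := (h01 p hpp hpz).1
    have hVp : 0 ≤ vprod g (primesProdBelow p) := (vprod_pos_of_lt h01 hpz.le).le
    -- `s_p = log D/log p - 1 ≥ s - 1 ≥ 1`
    have hsp : Real.log (D / p) / Real.log p = Real.log D / Real.log p - 1 := by
      rw [Real.log_div hD0.ne' hp0.ne']; field_simp
    have htp : s ≤ Real.log D / Real.log p :=
      div_le_div_of_nonneg_left hlogD.le hlogp hlogpz.le
    have hΦp : Φ p = contS 1 2 (m + 1) (Real.log (D / p) / Real.log p) / (Real.log (D / p) / Real.log p) +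
        (K - 1) * cN (m + 1) * major (m + 1) (Real.log (D / p) / Real.log p) := by
      simp only [hΦ, hΨ]
      rw [stepFun_of_two_le m K (by linarith), hsp]
    have hΦp0 : 0 ≤ Φ p := by
      simp only [hΦ, hΨ]; exact stepFun_nonneg m hK1 (by linarith)
    rw [Nat.mod_mod]
    by_cases hcond : (m % 2 = 1 → ((p : ℕ) : ℝ) ^ ((2 : ℝ) + 1) < D)
    · rw [if_pos hcond, bdrySum_congr_of_mod_two_eq (show (m % 2 + 1) % 2 = (m + 1) % 2 % 2 by omega)]
      have h := hIH p hp hcond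
      rw [← hΦp] at h
      calc g p * bdrySum ((m + 1) % 2) g 2 (D / p) (primesProdBelow p) (m + 1)
          ≤ g p * (vprod g (primesProdBelow p) * Φ p) := mul_le_mul_of_nonneg_left h hg0
        _ = g p * vprod g (primesProdBelow p) * Φ p := by ring
    · rw [if_neg hcond, zero_mul]
      exact mul_nonneg (mul_nonneg hg0 hVp) hΦp0
  -- Step 2: Lemma 9.8 at level `z`
  have hV : ∀ u : ℝ, 1 < u → u < z →
      vprod g (primesProdBelow u) ≤ K * (Real.log z / Real.log u) * vprod g (primesProdBelow z) :=
    fun u hu huz => hKC.vprod_le h01 hu huz le_rfl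
  have ht_ge : ∀ x ∈ Icc 2 z, s ≤ Real.log D / Real.log x := fun x hx =>
    div_le_div_of_nonneg_left hlogD.le (Real.log_pos (by linarith [hx.1]))
      (Real.log_le_log (by linarith [hx.1]) hx.2)
  have hΦ0 : ∀ x ∈ Icc 2 z, 0 ≤ Φ x := fun x hx => by
    simp only [hΦ, hΨ]; exact stepFun_nonneg m hK1 (by linarith [ht_ge x hx])
  have hΦm : MonotoneOn Φ (Icc 2 z) := by
    intro x hx y hy hxy
    simp only [hΦ, hΨ]
    refine stepFun_anti m hK1 (by linarith [ht_ge y hy]) ?_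
    exact div_le_div_of_nonneg_left hlogD.le (Real.log_pos (by linarith [hx.1]))
      (Real.log_le_log (by linarith [hx.1]) hxy)
  have hΦc : ContinuousOn Φ (Icc 2 z) := by
    refine (continuous_stepFun m K).comp_continuousOn ?_
    refine continuousOn_const.div (Real.continuousOn_log.mono fun x hx => ?_) fun x hx => ?_
    · exact ne_of_gt (by linarith [hx.1] : (0 : ℝ) < x)
    · exact (Real.log_pos (by linarith [hx.1])).ne'
  have h98 := sum_primesBelow_le_of_kTail hK1 hz hVz.le hV hΦ0 hΦm hΦc
  -- Step 3: the substitution `t = log D/log x`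
  set T₂ := Real.log D / Real.log 2 with hT₂
  have hsT₂ : s ≤ T₂ :=
    div_le_div_of_nonneg_left hlogD.le (Real.log_pos one_lt_two) (Real.log_le_log two_pos hz)
  have hsubst : ∫ x in (2 : ℝ)..z, Φ x * kTailDeriv K z x = K * (Real.log z / Real.log D) * ∫ t in s..T₂, Ψ t :=
    integral_comp_logRatio_mul_kTailDeriv one_lt_two hz hlogD.ne' (continuous_stepFun m K)
  have hzD : Real.log z / Real.log D = 1 / s := by rw [hs_def, one_div_div]
  -- Step 4: the integral of `Ψ` — (9.21) for the models and the transfer inequality for the majorants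
  have hint_split : ∫ t in s..T₂, Ψ t =
      (∫ t in s..T₂, contS 1 2 (m + 1) (t - 1) / max (t - 1) 1) +
        (K - 1) * cN (m + 1) * ∫ t in s..T₂, major (m + 1) (t - 1) := by
    simp only [hΨ, stepFun]
    rw [intervalIntegral.integral_add, intervalIntegral.integral_const_mul]
    · exact (((continuous_contS zero_le_one (by norm_num) (m + 1)).comp
        (continuous_id.sub continuous_const)).div
        ((continuous_id.sub continuous_const).max continuous_const) fun t =>
          ne_of_gt (lt_of_lt_of_le zero_lt_one (le_max_right _ _))).intervalIntegrable _ _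
    · exact (continuous_const.mul ((continuous_major (m + 1)).comp
        (continuous_id.sub continuous_const))).intervalIntegrable _ _
  have hA : ∫ t in s..T₂, contS 1 2 (m + 1) (t - 1) / max (t - 1) 1 ≤ contS 1 2 (m + 2) s := by
    set U := max T₂ (2 + m + 2) with hU
    have hU' : max s (2 + m + 2) ≤ U := max_le_max hsT₂ le_rfl
    have hrec := contS_succ_succ_eq_integral (κ := 1) zero_le_one (by norm_num : (1 : ℝ) < 2) m hs hU'
    have hcongr : ∫ t in s..T₂, contS 1 2 (m + 1) (t - 1) / max (t - 1) 1 =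
        ∫ t in s..T₂, sieveKernel 1 t * contS 1 2 (m + 1) (t - 1) := by
      refine intervalIntegral.integral_congr fun t ht => ?_
      rw [uIcc_of_le hsT₂] at ht
      rw [sieveKernel_one, max_eq_left (by linarith [ht.1]), div_eq_inv_mul]
    rw [hcongr, hrec]
    have hTU : T₂ ≤ U := le_max_left _ _
    refine intervalIntegral.integral_mono_interval le_rfl hsT₂ hTU ?_ ?_
    · refine (ae_restrict_mem measurableSet_Ioc).mono fun t ht => ?_
      exact mul_nonneg (sieveKernel_nonneg zero_le_one (by linarith [ht.1]))
        (contS_one_two_nonneg _ (by linarith [ht.1]))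
    · exact intervalIntegrable_sieveKernel_mul (continuous_contS zero_le_one (by norm_num) (m + 1)) hs1
        (hsT₂.trans hTU)
  have hB : ∫ t in s..T₂, major (m + 1) (t - 1) ≤ 9 / 10 * s * M := by
    rw [intervalIntegral.integral_comp_sub_right (fun u => major (m + 1) u) 1, hM]
    refine integral_major_succ_le (fun h0 => ?_) (fun h1 => ?_) (by linarith)
    · linarith
    · rw [parityShift_of_odd h1] at hs; linarith
  -- Step 5: the boundary term `Φ(z) = Ψ(s)`
  have hΦz : Φ z ≤ 8 * Real.exp 3 * alphaN ^ m * M + (K - 1) * cN (m + 1) * (4 * M) := by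
    have hΦz' : Φ z = contS 1 2 (m + 1) (s - 1) / (s - 1) + (K - 1) * cN (m + 1) * major (m + 1) (s - 1) := by
      simp only [hΦ, hΨ]; rw [stepFun_of_two_le m K hs2]
    rw [hΦz']
    -- Lemma 9.7 at `s - 1`, then `h(s-1) ≤ 4 h(s) ≤ 4e m_{m+2}(s)`
    have h97 := contS_le_majorant (m + 1) (s - 1) (by omega)
      (fun _ => by linarith) (fun h0 => by
        have h1 : m % 2 = 1 := by omega
        rw [parityShift_of_odd h1] at hs; linarith)
    rw [show m + 1 - 1 = m from rfl] at h97
    have hdiv : contS 1 2 (m + 1) (s - 1) / (s - 1) ≤ 2 * Real.exp 2 * alphaN ^ m * hFun (s - 1) := by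
      rw [div_le_iff₀ (by linarith)]
      calc contS 1 2 (m + 1) (s - 1) ≤ 2 * Real.exp 2 * alphaN ^ m * ((s - 1) * hFun (s - 1)) := h97
        _ = 2 * Real.exp 2 * alphaN ^ m * hFun (s - 1) * (s - 1) := by ring
    have hh : hFun (s - 1) ≤ 4 * (Real.exp 1 * M) :=
      (hFun_sub_one_le hs2).trans (mul_le_mul_of_nonneg_left (hFun_le_exp_mul_major (m + 2) s) (by norm_num))
    have hmaj : major (m + 1) (s - 1) ≤ 4 * M :=
      major_succ_sub_one_le (fun _ => hs2) (fun h1 => by rw [parityShift_of_odd h1] at hs; linarith)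
    have he : Real.exp 3 = Real.exp 2 * Real.exp 1 := by rw [← Real.exp_add]; norm_num
    have hαm : 0 ≤ alphaN ^ m := pow_nonneg alphaN_pos.le m
    have h1 : 2 * Real.exp 2 * alphaN ^ m * hFun (s - 1) ≤ 8 * Real.exp 3 * alphaN ^ m * M := by
      rw [he]
      have := mul_le_mul_of_nonneg_left hh (by positivity : (0 : ℝ) ≤ 2 * Real.exp 2 * alphaN ^ m)
      nlinarith [Real.exp_pos (2 : ℝ), Real.exp_pos (1 : ℝ)]
    have h2 : (K - 1) * cN (m + 1) * major (m + 1) (s - 1) ≤ (K - 1) * cN (m + 1) * (4 * M) :=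
      mul_le_mul_of_nonneg_left hmaj (mul_nonneg hK0 hc0.le)
    linarith
  -- Step 6: Lemma 9.7 for `n = m + 2` at `s` (the excess `(K - 1) f_{m+2}(s)`)
  have h97' : contS 1 2 (m + 2) s ≤ 2 * Real.exp 3 * alphaN ^ (m + 1) * (s * M) := by
    have := contS_le_major (n := m + 2) (by omega) (s := s) (fun _ => by linarith) (fun _ => hs2)
    rwa [show m + 2 - 1 = m + 1 from rfl] at this
  -- Step 7: assembly
  have hs0 : 0 < s := by linarith
  have htotal : (K - 1) * Φ z + ∫ x in (2 : ℝ)..z, Φ x * kTailDeriv K z x ≤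
      contS 1 2 (m + 2) s / s +
        (K - 1) * (cN (m + 1) * (9 / 10 * K + 4 * (K - 1)) + 10 * Real.exp 3 * alphaN ^ m) * M := by
    rw [hsubst, hzD, hint_split]
    have hK00 : 0 ≤ K := by linarith
    -- bound the integral part
    have hI : K * (1 / s) * ((∫ t in s..T₂, contS 1 2 (m + 1) (t - 1) / max (t - 1) 1) +
        (K - 1) * cN (m + 1) * ∫ t in s..T₂, major (m + 1) (t - 1)) ≤
        K * (1 / s) * (contS 1 2 (m + 2) s + (K - 1) * cN (m + 1) * (9 / 10 * s * M)) := by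
      refine mul_le_mul_of_nonneg_left (add_le_add hA ?_) (by positivity)
      exact mul_le_mul_of_nonneg_left hB (mul_nonneg hK0 hc0.le)
    have hE : K * (1 / s) * (contS 1 2 (m + 2) s + (K - 1) * cN (m + 1) * (9 / 10 * s * M)) =
        contS 1 2 (m + 2) s / s + (K - 1) * (contS 1 2 (m + 2) s / s) +
          (K - 1) * cN (m + 1) * (9 / 10 * K) * M := by
      field_simp; ring
    have hF : (K - 1) * (contS 1 2 (m + 2) s / s) ≤ (K - 1) * (2 * Real.exp 3 * alphaN ^ (m + 1) * M) := by
      refine mul_le_mul_of_nonneg_left ?_ hK0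
      rw [div_le_iff₀ hs0]
      linarith [h97']
    have hG : (K - 1) * Φ z ≤ (K - 1) * (8 * Real.exp 3 * alphaN ^ m * M + (K - 1) * cN (m + 1) * (4 * M)) :=
      mul_le_mul_of_nonneg_left hΦz hK0
    have hαm : 0 ≤ alphaN ^ m := pow_nonneg alphaN_pos.le m
    have hα1 : alphaN ≤ 1 := alphaN_lt_one.le
    have hH : 2 * Real.exp 3 * alphaN ^ (m + 1) * M ≤ 2 * Real.exp 3 * alphaN ^ m * M := by
      rw [pow_succ]
      have h1 : alphaN ^ m * alphaN ≤ alphaN ^ m := mul_le_of_le_one_right hαm hα1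
      have h2 : 0 ≤ 2 * Real.exp 3 * M := by positivity
      calc 2 * Real.exp 3 * (alphaN ^ m * alphaN) * M = 2 * Real.exp 3 * M * (alphaN ^ m * alphaN) := by ring
        _ ≤ 2 * Real.exp 3 * M * alphaN ^ m := mul_le_mul_of_nonneg_left h1 h2
        _ = 2 * Real.exp 3 * alphaN ^ m * M := by ring
    have hF' : (K - 1) * (2 * Real.exp 3 * alphaN ^ (m + 1) * M) ≤ (K - 1) * (2 * Real.exp 3 * alphaN ^ m * M) :=
      mul_le_mul_of_nonneg_left hH hK0
    linarith [hI, hE, hF, hG, hF']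
  calc bdrySum (m % 2) g 2 D (primesProdBelow z) (m + 2)
      ≤ ∑ p ∈ Nat.primesBelow ⌈z⌉₊, g p * vprod g (primesProdBelow p) * Φ p := hsum
    _ ≤ vprod g (primesProdBelow z) * ((K - 1) * Φ z + ∫ x in (2 : ℝ)..z, Φ x * kTailDeriv K z x) := h98
    _ ≤ _ := mul_le_mul_of_nonneg_left htotal hVz.le


/-! ### Theorem 9.5 -/

/-- `T_n(D, 1) = 0` for `n ≥ 1` (no divisors of `1` with `n` prime factors). [folklore] -/
theorem bdrySum_one_right {par : ℕ} {g : ArithmeticFunction ℝ} {β D : ℝ} {n : ℕ} (hn : 1 ≤ n) :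
    bdrySum par g β D 1 n = 0 := by
  rw [bdrySum]
  refine Finset.sum_eq_zero fun t ht => ?_
  rw [Finset.mem_filter, Nat.divisors_one, Finset.mem_singleton] at ht
  rw [ht.1, Nat.primeFactors_one, Finset.card_empty] at ht
  omega

/-- `log (D^{1/3}) = log D / 3`, `log z/log (D^{1/3}) = 3/s` and `D^{1/3} < z ↔ s < 3` bookkeeping.
[folklore] -/
theorem log_rpow_third {D : ℝ} (hD : 0 < D) : Real.log (D ^ (1 / ((2 : ℝ) + 1))) = Real.log D / 3 := by
  rw [Real.log_rpow hD]; ring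

/-- **Theorem 9.5** (Nathanson), explicit form with the majorants of this development: for
multiplicative `g` with `0 ≤ g(p) < 1` (`p < z`), `1 ≤ K ≤ 1 + 1/200`, the linear-sieve condition at
all levels `≤ z` (`KCond g K z`), `z ≥ 2` and `s = log D/log z ≥ 1` (`n` odd) resp. `≥ 2` (`n` even),
`T_n(D, z) ≤ V(z) (f_n(s) + (K − 1) c_n m_n(s))` where `s f_n(s) = contS 1 2 n s`, `c_n = 12000 α^n`,
`m_n ∈ {m_o, h}`. Proof by induction on `n` as printed (base case (9.13) with
`V(D^{1/3}) ≤ (3K/s) V(z)`; step `bdrySum_step`; for odd `n ≥ 3` and `s < 3` the reduction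
`T_n(D, z) = T_n(D, D^{1/3})`, see the erratum note in the module docstring).
[cite: Nathanson1996, Thm 9.5] -/
theorem bdrySum_le (hg : g.IsMultiplicative) (hK1 : 1 ≤ K) (hK2 : K ≤ 201 / 200) :
    ∀ (n : ℕ) (z D : ℝ), 1 ≤ n → KCond g K z →
      (∀ p : ℕ, p.Prime → (p : ℝ) < z → 0 ≤ g p ∧ g p < 1) → 2 ≤ z →
      (n % 2 = 1 → z ≤ D) → (n % 2 = 0 → z ^ 2 ≤ D) →
      bdrySum (n % 2) g 2 D (primesProdBelow z) n ≤
        vprod g (primesProdBelow z) *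
          (contS 1 2 n (Real.log D / Real.log z) / (Real.log D / Real.log z) +
            (K - 1) * cN n * major n (Real.log D / Real.log z))
  | 0, _, _, h, _, _, _, _, _ => absurd h (by norm_num)
  | 1, z, D, _, hKC, h01, hz, hodd, _ => by
    -- the base case (9.13): `T_1(D, z) = V(D^{1/3}) - V(z) ≤ (3K/s - 1) V(z)`
    set s := Real.log D / Real.log z with hs_def
    have hzD : z ≤ D := hodd rfl
    have hz1 : 1 < z := by linarith
    have hlogz : 0 < Real.log z := Real.log_pos hz1
    have hD0 : 0 < D := by linarith
    have hD1 : 1 < D := by linarith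
    have hlogD : 0 < Real.log D := Real.log_pos hD1
    have hs1 : 1 ≤ s := le_log_div_log_of_rpow_le hz1 (by rwa [Real.rpow_one])
    have hs0 : 0 < s := by linarith
    have hVz : 0 < vprod g (primesProdBelow z) := vprod_pos_of_lt h01 le_rfl
    have hK0 : 0 ≤ K - 1 := by linarith
    rw [show (1 : ℕ) % 2 = 1 from rfl, major_of_odd rfl, contS_one_one_two]
    have hc1 := three_le_cN_one_mul
    rcases le_or_gt 3 s with h3 | h3
    · -- `s ≥ 3`: `T_1 = 0`
      rw [bdrySum_eq_zero_of_card_add_le (par := 1) (g := g) (by norm_num : (0 : ℝ) < 2) hz1 hD0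
        (n := 1) (by push_cast; linarith)]
      rw [min_eq_right h3, sub_self, zero_div, zero_add]
      exact mul_nonneg hVz.le (mul_nonneg (mul_nonneg hK0 (cN_pos 1).le) (moFun_pos s).le)
    · -- `1 ≤ s < 3`
      set z₃ := D ^ (1 / ((2 : ℝ) + 1)) with hz₃
      have hz₃0 : 0 < z₃ := Real.rpow_pos_of_pos hD0 _
      have hlog3 : Real.log z₃ = Real.log D / 3 := log_rpow_third hD0
      have hz₃1 : 1 < z₃ := Real.one_lt_rpow hD1 (by norm_num)
      have hz₃z : z₃ < z := by
        rw [← Real.log_lt_log_iff hz₃0 (by linarith), hlog3]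
        rw [hs_def, div_lt_iff₀ hlogz] at h3
        linarith
      rw [bdrySum_one_one_eq (g := g) hD0.le (by norm_num : (0 : ℝ) < 2 + 1) hz₃z.le]
      have hV3 := hKC.vprod_le h01 hz₃1 hz₃z le_rfl
      have hratio : Real.log z / Real.log z₃ = 3 / s := by rw [hlog3, hs_def]; field_simp
      rw [hratio] at hV3
      rw [min_eq_left h3.le, moFun_of_mem hs1 h3.le]
      -- `3(K-1)/s ≤ (K-1) c_1 (3e^{-3}/s)`
      have hkey : vprod g (primesProdBelow z) * (3 * K / s - 1) ≤
          vprod g (primesProdBelow z) * ((3 - s) / s + (K - 1) * cN 1 * (3 * Real.exp (-3) / s)) := by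
        refine mul_le_mul_of_nonneg_left ?_ hVz.le
        rw [show (K - 1) * cN 1 * (3 * Real.exp (-3) / s) = (K - 1) * (cN 1 * (3 * Real.exp (-3))) / s by ring,
          show 3 * K / s - 1 = (3 - s) / s + (K - 1) * 3 / s by field_simp; ring]
        refine add_le_add le_rfl (div_le_div_of_nonneg_right ?_ hs0.le)
        exact mul_le_mul_of_nonneg_left hc1 hK0
      have : vprod g (primesProdBelow z₃) - vprod g (primesProdBelow z) ≤
          vprod g (primesProdBelow z) * (3 * K / s - 1) := by
        have : K * (3 / s) * vprod g (primesProdBelow z) = vprod g (primesProdBelow z) * (3 * K / s - 1) +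
            vprod g (primesProdBelow z) := by ring
        linarith
      exact this.trans hkey
  | m + 2, z, D, _, hKC, h01, hz, hodd, heven => by
    set s := Real.log D / Real.log z with hs_def
    have hz1 : 1 < z := by linarith
    have hz0 : 0 < z := by linarith
    have hlogz : 0 < Real.log z := Real.log_pos hz1
    have hD1 : 1 < D := by
      rcases Nat.mod_two_eq_zero_or_one (m + 2) with h0 | h1
      · have := heven h0; nlinarith
      · have := hodd h1; linarith
    have hD0 : 0 < D := by linarith
    have hlogD : 0 < Real.log D := Real.log_pos hD1
    have hVz : 0 < vprod g (primesProdBelow z) := vprod_pos_of_lt h01 le_rfl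
    have hK0 : 0 ≤ K - 1 := by linarith
    have hsodd : (m + 2) % 2 = 1 → 1 ≤ s := fun h1 =>
      le_log_div_log_of_rpow_le hz1 (by rw [Real.rpow_one]; exact hodd h1)
    have hseven : (m + 2) % 2 = 0 → 2 ≤ s := fun h0 =>
      le_log_div_log_of_rpow_le hz1 (by rw [show (2 : ℝ) = (2 : ℕ) by norm_num, Real.rpow_natCast]; exact heven h0)
    have hstep_const := cN_step hK1 hK2 m
    set c' := cN (m + 1) * (9 / 10 * K + 4 * (K - 1)) + 10 * Real.exp 3 * alphaN ^ m with hc'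
    have hc'0 : 0 ≤ c' := by
      have := cN_pos (m + 1); have := alphaN_pos; positivity
    -- the coefficient inequality `c' ≤ c_{m+2}` (and `K c' + 2e³ α^{m+1} ≤ c_{m+2}`)
    have hcoef : c' ≤ cN (m + 2) := by
      have h1 : c' ≤ K * c' := le_mul_of_one_le_left hc'0 hK1
      have h2 : 0 ≤ 2 * Real.exp 3 * alphaN ^ (m + 1) := by have := alphaN_pos; positivity
      linarith
    rw [show (m + 2) % 2 = m % 2 by omega]
    -- the induction hypothesis at the primes below a level `w ≤ z`, for the level `D`
    have hIH : ∀ (w : ℝ), w ≤ z → (m % 2 = 0 → z ^ 2 ≤ D) →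
        ∀ p ∈ Nat.primesBelow ⌈w⌉₊, (m % 2 = 1 → ((p : ℕ) : ℝ) ^ ((2 : ℝ) + 1) < D) →
          bdrySum ((m + 1) % 2) g 2 (D / p) (primesProdBelow p) (m + 1) ≤
            vprod g (primesProdBelow p) *
              (contS 1 2 (m + 1) (Real.log (D / p) / Real.log p) / (Real.log (D / p) / Real.log p) +
                (K - 1) * cN (m + 1) * major (m + 1) (Real.log (D / p) / Real.log p)) := by
      intro w hwz hev p hp hguard
      have hpp : p.Prime := Nat.prime_of_mem_primesBelow hp
      have hpw : (p : ℝ) < w := Nat.lt_ceil.mp (Nat.lt_of_mem_primesBelow hp)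
      have hpz : (p : ℝ) < z := lt_of_lt_of_le hpw hwz
      have hp2 : (2 : ℝ) ≤ p := by exact_mod_cast hpp.two_le
      have hp0 : (0 : ℝ) < p := by linarith
      refine bdrySum_le hg hK1 hK2 (m + 1) p (D / p) (by omega) (hKC.mono hpz.le)
        (fun q hq hqp => h01 q hq (hqp.trans hpz)) hp2 (fun h1 => ?_) (fun h0 => ?_)
      · -- `m` even: `p² < z² ≤ D`
        have hzz : z ^ 2 ≤ D := hev (by omega)
        rw [le_div_iff₀ hp0]
        nlinarith
      · -- `m` odd: `p³ < D` from the truncation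
        have h3 : ((p : ℕ) : ℝ) ^ ((2 : ℝ) + 1) < D := hguard (by omega)
        rw [show (2 : ℝ) + 1 = ((3 : ℕ) : ℝ) by norm_num, Real.rpow_natCast] at h3
        rw [le_div_iff₀ hp0]
        nlinarith
    by_cases hA : 2 + parityShift m ≤ s
    · -- Case A: the step at level `z`
      have h := bdrySum_step hg h01 hK1 hKC hz m hD1 hA (hIH z le_rfl (fun h0 => heven (by omega)))
      rw [← hs_def, ← hc'] at h
      refine h.trans (mul_le_mul_of_nonneg_left ?_ hVz.le)
      have hM0 : 0 ≤ major (m + 2) s := (major_pos _ _).le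
      have : (K - 1) * c' * major (m + 2) s ≤ (K - 1) * cN (m + 2) * major (m + 2) s :=
        mul_le_mul_of_nonneg_right (mul_le_mul_of_nonneg_left hcoef hK0) hM0
      linarith
    · -- Case B: `n` odd, `1 ≤ s < 3`; reduce to the level `z₃ = D^{1/3}` where `s = 3`
      have hm1 : m % 2 = 1 := by
        by_contra h0
        have h0' : m % 2 = 0 := by omega
        rw [parityShift_of_even h0'] at hA
        exact hA (by linarith [hseven (by omega)])
      have hs1 : 1 ≤ s := hsodd (by omega)
      rw [parityShift_of_odd hm1] at hA
      have hs3 : s < 3 := by linarith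
      set z₃ := D ^ (1 / ((2 : ℝ) + 1)) with hz₃
      have hz₃0 : 0 < z₃ := Real.rpow_pos_of_pos hD0 _
      have hlog3 : Real.log z₃ = Real.log D / 3 := log_rpow_third hD0
      have hz₃z : z₃ < z := by
        rw [← Real.log_lt_log_iff hz₃0 hz0, hlog3]
        rw [hs_def, div_lt_iff₀ hlogz] at hs3
        linarith
      have hred : bdrySum (m % 2) g 2 D (primesProdBelow z) (m + 2) =
          bdrySum (m % 2) g 2 D (primesProdBelow z₃) (m + 2) := by
        rw [hm1]
        exact bdrySum_one_succ_succ_eq hg hD0.le (by norm_num : (0 : ℝ) < 2 + 1) hz₃z.le m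
      rw [hred, major_of_odd (by omega)]
      rcases le_or_gt z₃ 2 with hsmall | hbig
      · -- `z₃ ≤ 2`: nothing to sift at level `z₃`
        have hP1 : primesProdBelow z₃ = 1 :=
          Nat.dvd_one.mp (SieveSequence.primesProdBelow_two ▸ SieveSequence.primesProdBelow_dvd hsmall)
        rw [hP1, bdrySum_one_right (by omega)]
        refine mul_nonneg hVz.le (add_nonneg (div_nonneg (contS_one_two_nonneg _ (by linarith)) (by linarith)) ?_)
        exact mul_nonneg (mul_nonneg hK0 (cN_pos _).le) (moFun_pos s).le
      · -- `2 < z₃ < z`: the step at level `z₃` (`s = 3`), then `V(z₃) ≤ (3K/s) V(z)`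
        have hs₃ : Real.log D / Real.log z₃ = 3 := by
          rw [hlog3]; field_simp
        have h01' : ∀ p : ℕ, p.Prime → (p : ℝ) < z₃ → 0 ≤ g p ∧ g p < 1 :=
          fun q hq hqz => h01 q hq (hqz.trans hz₃z)
        have hA3 : 2 + parityShift m ≤ Real.log D / Real.log z₃ := by
          rw [parityShift_of_odd hm1, hs₃]; norm_num
        have h := bdrySum_step hg h01' hK1 (hKC.mono hz₃z.le) hbig.le m hD1 hA3
          (hIH z₃ hz₃z.le (fun h0 => by omega))
        rw [hs₃] at h
        have hz₃1 : 1 < z₃ := by linarith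
        have hV3 := hKC.vprod_le h01 hz₃1 hz₃z le_rfl
        have hratio : Real.log z / Real.log z₃ = 3 / s := by rw [hlog3, hs_def]; field_simp
        rw [hratio] at hV3
        -- `S_n(3) = S_n(s)` and `m_o(s) = (3/s) m_o(3)`
        have hS3 : contS 1 2 (m + 2) s = contS 1 2 (m + 2) 3 := by
          have := contS_odd_eq_of_le (κ := 1) (β := 2) (n := m + 2) (by omega) (by omega) (s := s)
            (by norm_num; exact hs3.le)
          norm_num at this; exact this
        have hmo : moFun s = 3 / s * moFun 3 := moFun_eq_div_mul hs1 hs3.le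
        have hmaj3 : major (m + 2) 3 = moFun 3 := major_of_odd (by omega) 3
        rw [hmaj3] at h
        have hs0 : 0 < s := by linarith
        have hmo3 : 0 < moFun 3 := moFun_pos 3
        have hS0 : 0 ≤ contS 1 2 (m + 2) 3 := contS_one_two_nonneg _ (by norm_num)
        -- Lemma 9.7 for the excess `(K-1) f_n(s)`
        have h97 : contS 1 2 (m + 2) s ≤ 2 * Real.exp 3 * alphaN ^ (m + 1) * (s * moFun s) := by
          have := contS_le_major (n := m + 2) (by omega) (s := s) (fun _ => hs1) (fun h0 => by omega)
          rwa [show m + 2 - 1 = m + 1 from rfl, major_of_odd (by omega)] at this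
        -- assemble: `T ≤ V(z₃)(S_n(3)/3 + (K-1) c' m_o(3)) ≤ (3K/s) V(z) (…)`
        have hinner0 : 0 ≤ contS 1 2 (m + 2) 3 / 3 + (K - 1) * c' * moFun 3 := by positivity
        calc bdrySum (m % 2) g 2 D (primesProdBelow z₃) (m + 2)
            ≤ vprod g (primesProdBelow z₃) * (contS 1 2 (m + 2) 3 / 3 + (K - 1) * c' * moFun 3) := h
          _ ≤ K * (3 / s) * vprod g (primesProdBelow z) *
              (contS 1 2 (m + 2) 3 / 3 + (K - 1) * c' * moFun 3) :=
              mul_le_mul_of_nonneg_right hV3 hinner0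
          _ = vprod g (primesProdBelow z) *
              (contS 1 2 (m + 2) s / s + (K - 1) * (contS 1 2 (m + 2) s / s) +
                (K - 1) * (K * c') * moFun s) := by
              rw [hS3, hmo]; field_simp; ring
          _ ≤ vprod g (primesProdBelow z) *
              (contS 1 2 (m + 2) s / s + (K - 1) * cN (m + 2) * moFun s) := by
              refine mul_le_mul_of_nonneg_left ?_ hVz.le
              have h1 : (K - 1) * (contS 1 2 (m + 2) s / s) ≤
                  (K - 1) * (2 * Real.exp 3 * alphaN ^ (m + 1) * moFun s) := by
                refine mul_le_mul_of_nonneg_left ?_ hK0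
                rw [div_le_iff₀ hs0]; linarith [h97]
              have h2 : (K - 1) * (K * c') * moFun s + (K - 1) * (2 * Real.exp 3 * alphaN ^ (m + 1) * moFun s)
                  ≤ (K - 1) * cN (m + 2) * moFun s := by
                have : (K * c' + 2 * Real.exp 3 * alphaN ^ (m + 1)) * ((K - 1) * moFun s) ≤
                    cN (m + 2) * ((K - 1) * moFun s) :=
                  mul_le_mul_of_nonneg_right hstep_const (mul_nonneg hK0 (moFun_pos s).le)
                linarith
              linarith


/-! ### Theorem 9.6 (upper bound) with `F(s) = 2e^γ/s` -/

/-- `∑_{n ≤ N} α^n ≤ 26` (`1/(1 − α) ≤ 25.7`). [folklore] -/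
theorem sum_alphaN_pow_le (N : ℕ) : ∑ n ∈ Finset.range (N + 1), alphaN ^ n ≤ 26 := by
  obtain ⟨hα1, hα2⟩ := alphaN_bounds
  have h := geom_sum_mul_neg alphaN (N + 1)
  have hpow : 0 ≤ alphaN ^ (N + 1) := pow_nonneg alphaN_pos.le _
  have hS : 0 ≤ ∑ n ∈ Finset.range (N + 1), alphaN ^ n :=
    Finset.sum_nonneg fun n _ => pow_nonneg alphaN_pos.le n
  nlinarith

/-- **Theorem 9.6, upper bound, with Theorem 9.8** (Nathanson): for multiplicative `g` with
`0 ≤ g(p) < 1` (`p < z`), the linear-sieve condition at all levels `≤ z` with `1 ≤ K ≤ 1 + 1/200`,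
`z ≥ 2`, `z ≤ D` and `s = log D/log z ≤ 3`:
`G(z, λ⁺) = ∑_{d ∣ P(z)} μ(d) χ⁺_D(d) g(d) ≤ V(z) (2e^γ/s + (K − 1) e^{14−s})`
(printed: `G(z, λ⁺) < V(z)(F(s) + ε e^{14−s})`, `K = 1 + ε`, with `F(s) = 2e^γ/s` for `1 ≤ s ≤ 3` by
Theorem 9.8). From (9.10) (`BetaSieve.mainSum_one_eq`), Theorem 9.5 (`bdrySum_le`),
`1 + Σ_{n odd} f_n(s) ≤ 2e^γ/s` (`add_contT_one_le`) and the error budget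
`Σ_n c_n ≤ 12000 · 26`, `12000 · 26 · m_o(s) ≤ e^{14−s}`. [cite: Nathanson1996, Thm 9.6 and Thm 9.8] -/
theorem mainSum_one_le (hg : g.IsMultiplicative) (hK1 : 1 ≤ K) (hK2 : K ≤ 201 / 200) {z D : ℝ}
    (hKC : KCond g K z) (h01 : ∀ p : ℕ, p.Prime → (p : ℝ) < z → 0 ≤ g p ∧ g p < 1) (hz : 2 ≤ z)
    (hzD : z ≤ D) (hs3 : Real.log D / Real.log z ≤ 3) :
    mainSum 1 g 2 D (primesProdBelow z) ≤
      vprod g (primesProdBelow z) *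
        (2 * Real.exp Real.eulerMascheroniConstant / (Real.log D / Real.log z) +
          (K - 1) * Real.exp (14 - Real.log D / Real.log z)) := by
  set s := Real.log D / Real.log z with hs_def
  set P := primesProdBelow z with hP
  set V := vprod g P with hV
  set N := P.primeFactors.card with hN
  have hz1 : 1 < z := by linarith
  have hs1 : 1 ≤ s := le_log_div_log_of_rpow_le hz1 (by rwa [Real.rpow_one])
  have hs0 : 0 < s := by linarith
  have hV0 : 0 < V := vprod_pos_of_lt h01 le_rfl
  have hK0 : 0 ≤ K - 1 := by linarith
  have hmo0 : 0 < moFun s := moFun_pos s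
  rw [mainSum_one_eq hg (squarefree_primesProdBelow z) 2 D]
  -- termwise: even `n` vanish, odd `n` by Theorem 9.5
  set b : ℕ → ℝ := fun n => if n % 2 = 1 % 2 then V * (contS 1 2 n s / s + (K - 1) * cN n * moFun s) else 0
    with hb
  have hterm : ∀ n ∈ Finset.range (N + 1), bdrySum 1 g 2 D P n ≤ b n := by
    intro n _
    simp only [hb]
    by_cases hn : n % 2 = 1 % 2
    · rw [if_pos hn, bdrySum_congr_of_mod_two_eq (show 1 % 2 = n % 2 % 2 by omega)]
      have h := bdrySum_le hg hK1 hK2 n z D (by omega) hKC h01 hz (fun _ => hzD) (fun h0 => by omega)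
      rwa [major_of_odd (by omega), ← hs_def] at h
    · rw [if_neg hn, bdrySum_eq_zero_of_mod_two_ne g 2 D P hn]
  have hsumb : ∑ n ∈ Finset.range (N + 1), b n =
      V * (contT 1 1 2 N s / s) + V * ((K - 1) * moFun s) *
        ∑ n ∈ (Finset.range (N + 1)).filter (fun n => n % 2 = 1 % 2), cN n := by
    simp only [hb]
    rw [← Finset.sum_filter, contT_def, Finset.mul_sum, Finset.sum_div, Finset.mul_sum,
      ← Finset.sum_add_distrib]
    refine Finset.sum_congr rfl fun n _ => ?_
    ring
  have hgeom : ∑ n ∈ (Finset.range (N + 1)).filter (fun n => n % 2 = 1 % 2), cN n ≤ 12000 * 26 := by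
    calc ∑ n ∈ (Finset.range (N + 1)).filter (fun n => n % 2 = 1 % 2), cN n
        ≤ ∑ n ∈ Finset.range (N + 1), cN n :=
          Finset.sum_le_sum_of_subset_of_nonneg (Finset.filter_subset _ _) fun n _ _ => (cN_pos n).le
      _ = 12000 * ∑ n ∈ Finset.range (N + 1), alphaN ^ n := by rw [Finset.mul_sum]; rfl
      _ ≤ 12000 * 26 := by nlinarith [sum_alphaN_pow_le N]
  have hmain := add_contT_one_le N hs0 hs3
  have herr := errorBudget hs1 hs3
  calc V + ∑ n ∈ Finset.range (N + 1), bdrySum 1 g 2 D P n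
      ≤ V + ∑ n ∈ Finset.range (N + 1), b n := by
        have := Finset.sum_le_sum hterm; linarith
    _ = V + (V * (contT 1 1 2 N s / s) + V * ((K - 1) * moFun s) *
          ∑ n ∈ (Finset.range (N + 1)).filter (fun n => n % 2 = 1 % 2), cN n) := by rw [hsumb]
    _ ≤ V + (V * (contT 1 1 2 N s / s) + V * ((K - 1) * moFun s) * (12000 * 26)) := by
        have : 0 ≤ V * ((K - 1) * moFun s) := by positivity
        nlinarith [hgeom]
    _ = V * ((s + contT 1 1 2 N s) / s + (K - 1) * (12000 * 26 * moFun s)) := by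
        field_simp; ring
    _ ≤ V * (2 * Real.exp Real.eulerMascheroniConstant / s + (K - 1) * Real.exp (14 - s)) := by
        refine mul_le_mul_of_nonneg_left (add_le_add ?_ ?_) hV0.le
        · exact div_le_div_of_nonneg_right hmain hs0.le
        · exact mul_le_mul_of_nonneg_left herr hK0

end JurkatRichert

end Literature.NumberTheory.Sieve
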